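import Mathlib.CategoryTheory.Limits.FullSubcategory
import Mathlib.CategoryTheory.Limits.Preserves.Shapes.BinaryProducts
import Literature.AnabelianGeometry.SemiGraphs.QuasiTemperoidsQDPairs
import Literature.AnabelianGeometry.SemiGraphs.QuasiTemperoidsRemarksProofs
import Literature.AnabelianGeometry.SemiGraphs.BTempCoproductsProofs
import HarnessLib

/-!
# Semi-graphs of anabelioids, Appendix: connected components in `T[A] ⊆ B^temp(Π)` (proofs)

Mochizuki, *Semi-graphs of anabelioids*, Publ. RIMS **42** (2006), Appendix, p. 79 ("`π₀(A)`, the set of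
connected components of `A`") and Definition A.3 (i), p. 82 [cite: MochizukiSemiAnbd2006, Def A.3(i) p.82].
PROOF-ONLY companion of `QuasiTemperoidsQDPairs.lean` (abc-iut-L3-t2), first of the files discharging the
named fact `QDPair.QuotientConnectedIffWeaklyConnected` ("the quotient of a QD-pair is connected iff the
QD-pair is weakly connected"): the dictionary, inside a chart `T[A] = Over' A ⊆ B^temp(Π)`, between the
typed notion of a *component* (`IsComponent ι`: `ι : C → X` a coprojection of a binary coproduct with `C`
connected) and the `Π`-orbits of the underlying `Π`-set of `X`:

* `overPrime_isConnectedObj_iff_transitive` — an object of `T[A]` is connected iff its underlying `Π`-set is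
  nonempty and transitive (the `B^temp(Π)` statement `BTemp.isConnectedObj_iff` of abc-iut-L3-t5,
  transferred along the full inclusion, which preserves and reflects binary coproducts);
* `overPrime_binaryCofan_inl_injective`, `…_disjoint` — coprojections of binary coproducts in `T[A]` are
  injective with disjoint images (coproducts are disjoint unions, `BTemp.cofan_inj_injective`);
* `IsComponent.injective`, `IsComponent.exists_ρ_eq`, `IsComponent.nonempty` — a component is injective
  on points with image a single `Π`-orbit;
* `overPrime_exists_isComponent_orbit` — conversely every `Π`-orbit of `X` is the image of a component.

No definitions; nothing here takes a side on [IUTchIII] Cor. 3.12.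
-/

open CategoryTheory CategoryTheory.Limits Topology

namespace Literature.AnabelianGeometry.SemiGraphs

open Literature.AlgebraicGeometry.Frobenioids (IsConnectedObj IsNonemptyObj)

universe u

variable {G : Type u} [Group G] [TopologicalSpace G] [IsTopologicalGroup G]

omit [IsTopologicalGroup G] in
/-- Equivariance of a morphism of `B^temp(Π)`, pointwise. [folklore] -/
private theorem hom_ρ {X Y : BTemp G} (f : X ⟶ Y) (g : G) (x : X.obj.V) :
    f.hom.hom (X.obj.ρ g x) = Y.obj.ρ g (f.hom.hom x) := by
  have e := ConcreteCategory.congr_hom (f.hom.comm g) x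
  simp only [types_comp_apply] at e
  exact e

/-! ### Binary coproducts in `T[A]`: computed in `B^temp(Π)`, i.e. disjoint unions -/

/-- `B^temp(Π)` has binary coproducts (countable coproducts, [SemiAnbd] Rmk 3.1.5).
[cite: MochizukiSemiAnbd2006, Rmk 3.1.5 p.34] -/
private theorem bTemp_hasColimitsOfShape_pair :
    HasColimitsOfShape (Discrete WalkingPair) (BTemp G) := by
  haveI := BTemp.isClosedUnderColimitsOfShape_discrete (G := G) WalkingPair
  exact hasColimitsOfShape_of_closedUnderColimits _ _

/-- The inclusion `T[A] ⥤ B^temp(Π)` preserves binary coproducts (`T[A]` is closed under them).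
[cite: MochizukiSemiAnbd2006, Def A.1(i) p.79] -/
private theorem overPrime_ι_preserves_pair (A : BTemp G) :
    PreservesColimitsOfShape (Discrete WalkingPair) (admitsHomTo A).ι := by
  haveI := bTemp_hasColimitsOfShape_pair (G := G)
  haveI : (admitsHomTo A).IsClosedUnderColimitsOfShape (Discrete WalkingPair) :=
    ⟨fun _ hX => by
      obtain ⟨p⟩ := hX
      exact ⟨p.isColimit.desc (Cocone.mk A (Discrete.natTrans fun j => (p.prop_diag_obj j).some))⟩⟩
  infer_instance

/-- A colimit binary cofan of `T[A]` stays a colimit binary cofan in `B^temp(Π)`.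
[cite: MochizukiSemiAnbd2006, Def A.1(i) p.79] -/
theorem overPrime_binaryCofan_isColimit_obj {A : BTemp G} {C D X : Over' A} (ι : C ⟶ X) (κ : D ⟶ X)
    (hc : IsColimit (BinaryCofan.mk ι κ)) : Nonempty (IsColimit (BinaryCofan.mk ι.hom κ.hom)) := by
  haveI := overPrime_ι_preserves_pair (G := G) A
  exact ⟨mapIsColimitOfPreservesOfIsColimit (admitsHomTo A).ι ι κ hc⟩

omit [IsTopologicalGroup G] in
/-- A binary cofan of `T[A]` which is a colimit in `B^temp(Π)` is a colimit in `T[A]` (the inclusion is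
fully faithful). [cite: MochizukiSemiAnbd2006, Def A.1(i) p.79] -/
theorem overPrime_binaryCofan_isColimit_of_obj {A : BTemp G} {C D X : Over' A} (ι : C ⟶ X)
    (κ : D ⟶ X) (hc : IsColimit (BinaryCofan.mk ι.hom κ.hom)) :
    Nonempty (IsColimit (BinaryCofan.mk ι κ)) :=
  ⟨isColimitOfReflectsOfMapIsColimit (admitsHomTo A).ι ι κ hc⟩

omit [IsTopologicalGroup G] in
/-- A colimit binary cofan of `B^temp(Π)` as a colimit cofan over the walking pair. [folklore] -/
private theorem bTemp_isColimit_cofan_of_binaryCofan {C D X : BTemp G} (ι : C ⟶ X) (κ : D ⟶ X)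
    (hc : IsColimit (BinaryCofan.mk ι κ)) :
    Nonempty (IsColimit (Cofan.mk X
      (fun j => WalkingPair.casesOn (motive := fun j => pairFunction C D j ⟶ X) j ι κ))) :=
  ⟨hc.ofIsoColimit (Cocone.ext (Iso.refl _) (by rintro ⟨⟨⟩ | ⟨⟩⟩ <;> exact Category.comp_id _))⟩

/-- **Coproducts in `T[A]` are disjoint unions, I**: a coprojection of a binary coproduct is injective
on points. [cite: MochizukiSemiAnbd2006, Appendix p.79] -/
theorem overPrime_binaryCofan_inl_injective {A : BTemp G} {C D X : Over' A} (ι : C ⟶ X) (κ : D ⟶ X)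
    (hc : IsColimit (BinaryCofan.mk ι κ)) :
    Function.Injective fun c : C.obj.obj.V => (ι.hom.hom.hom c : X.obj.obj.V) := by
  obtain ⟨hc'⟩ := overPrime_binaryCofan_isColimit_obj ι κ hc
  obtain ⟨hc''⟩ := bTemp_isColimit_cofan_of_binaryCofan ι.hom κ.hom hc'
  exact BTemp.cofan_inj_injective _ hc'' WalkingPair.left

/-- **Coproducts in `T[A]` are disjoint unions, II**: the two coprojections of a binary coproduct have
disjoint images. [cite: MochizukiSemiAnbd2006, Appendix p.79] -/
theorem overPrime_binaryCofan_disjoint {A : BTemp G} {C D X : Over' A} (ι : C ⟶ X) (κ : D ⟶ X)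
    (hc : IsColimit (BinaryCofan.mk ι κ)) (c : C.obj.obj.V) (d : D.obj.obj.V) :
    (ι.hom.hom.hom c : X.obj.obj.V) ≠ κ.hom.hom.hom d := by
  obtain ⟨hc'⟩ := overPrime_binaryCofan_isColimit_obj ι κ hc
  obtain ⟨hc''⟩ := bTemp_isColimit_cofan_of_binaryCofan ι.hom κ.hom hc'
  intro h
  exact WalkingPair.noConfusion
    (BTemp.cofan_eq_of_inj_apply_eq _ hc'' (i := WalkingPair.left) (j := WalkingPair.right) c d h)

/-- **Coproducts in `T[A]` are disjoint unions, III**: the two coprojections of a binary coproduct are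
jointly surjective on points. [cite: MochizukiSemiAnbd2006, Appendix p.79] -/
theorem overPrime_binaryCofan_jointly_surjective {A : BTemp G} {C D X : Over' A} (ι : C ⟶ X)
    (κ : D ⟶ X) (hc : IsColimit (BinaryCofan.mk ι κ)) (x : X.obj.obj.V) :
    (∃ c : C.obj.obj.V, ι.hom.hom.hom c = x) ∨ ∃ d : D.obj.obj.V, κ.hom.hom.hom d = x := by
  obtain ⟨hc'⟩ := overPrime_binaryCofan_isColimit_obj ι κ hc
  obtain ⟨hc''⟩ := bTemp_isColimit_cofan_of_binaryCofan ι.hom κ.hom hc'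
  obtain ⟨j, y, hy⟩ := BTemp.cofan_inj_jointly_surjective _ hc'' x
  cases j with
  | left => exact Or.inl ⟨y, hy⟩
  | right => exact Or.inr ⟨y, hy⟩

/-! ### Connected objects of `T[A]`: nonempty transitive `Π`-sets -/

omit [IsTopologicalGroup G] in
/-- **An object of `T[A]` is connected iff its underlying `Π`-set is nonempty and transitive.**  The
`B^temp(Π)` statement is `BTemp.isConnectedObj_iff`; a binary-cofan decomposition in `B^temp(Π)` with
nonempty legs lifts to `T[A]` (the legs map to `A` through `X`) and is reflected by the full inclusion.
[cite: MochizukiSemiAnbd2006, Def A.1(i) p.79] -/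
theorem overPrime_isConnectedObj_iff_transitive {A : BTemp G} (X : Over' A) :
    IsConnectedObj X ↔
      Nonempty X.obj.obj.V ∧ ∀ x y : X.obj.obj.V, ∃ g : G, X.obj.obj.ρ g x = y := by
  refine ⟨fun hX => (BTemp.isConnectedObj_iff X.obj).mp ⟨?_, fun B₁ B₂ ι₁ ι₂ hB₁ hB₂ => ⟨fun hc => ?_⟩⟩,
    fun h => overPrime_isConnectedObj_of_isConnectedObj X ((BTemp.isConnectedObj_iff X.obj).mpr h)⟩
  · exact (BTemp.isNonemptyObj_iff X.obj).mpr (overPrime_nonempty_of_isNonemptyObj hX.1)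
  · obtain ⟨pX⟩ := X.property
    let B₁' : Over' A := ⟨B₁, ⟨ι₁ ≫ pX⟩⟩
    let B₂' : Over' A := ⟨B₂, ⟨ι₂ ≫ pX⟩⟩
    let ι₁' : B₁' ⟶ X := ObjectProperty.homMk ι₁
    let ι₂' : B₂' ⟶ X := ObjectProperty.homMk ι₂
    obtain ⟨hc'⟩ := overPrime_binaryCofan_isColimit_of_obj ι₁' ι₂' hc
    have hne₁ : IsNonemptyObj B₁' :=
      ⟨fun hI => (overPrime_isEmpty_of_isInitial hI).false ((BTemp.isNonemptyObj_iff B₁).mp hB₁).some⟩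
    have hne₂ : IsNonemptyObj B₂' :=
      ⟨fun hI => (overPrime_isEmpty_of_isInitial hI).false ((BTemp.isNonemptyObj_iff B₂).mp hB₂).some⟩
    exact (hX.2 B₁' B₂' ι₁' ι₂' hne₁ hne₂).false hc'

/-! ### Components of an object of `T[A]` are injective with image one `Π`-orbit -/

namespace IsComponent

variable {A : BTemp G} {C X : Over' A} {ι : C ⟶ X}

/-- A component is injective on points. [cite: MochizukiSemiAnbd2006, Appendix p.79] -/
theorem injective (h : IsComponent ι) :
    Function.Injective fun c : C.obj.obj.V => (ι.hom.hom.hom c : X.obj.obj.V) := by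
  obtain ⟨-, D, κ, ⟨hc⟩⟩ := h
  exact overPrime_binaryCofan_inl_injective ι κ hc

omit [IsTopologicalGroup G] in
/-- The domain of a component has a point. [cite: MochizukiSemiAnbd2006, Appendix p.79] -/
theorem nonempty (h : IsComponent ι) : Nonempty C.obj.obj.V :=
  ((overPrime_isConnectedObj_iff_transitive C).mp h.1).1

omit [IsTopologicalGroup G] in
/-- Any two points of (the image of) a component are `Π`-translates of each other: the image is one
`Π`-orbit. [cite: MochizukiSemiAnbd2006, Appendix p.79] -/
theorem exists_ρ_eq (h : IsComponent ι) (c c' : C.obj.obj.V) :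
    ∃ g : G, X.obj.obj.ρ g (ι.hom.hom.hom c) = ι.hom.hom.hom c' := by
  obtain ⟨g, hg⟩ := ((overPrime_isConnectedObj_iff_transitive C).mp h.1).2 c c'
  exact ⟨g, by rw [← hom_ρ ι.hom g c, hg]⟩

omit [IsTopologicalGroup G] in
/-- The image of a component is `Π`-stable. [cite: MochizukiSemiAnbd2006, Appendix p.79] -/
theorem ρ_mem_range (_h : IsComponent ι) (g : G) (c : C.obj.obj.V) :
    ∃ c' : C.obj.obj.V, ι.hom.hom.hom c' = X.obj.obj.ρ g (ι.hom.hom.hom c) :=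
  ⟨C.obj.obj.ρ g c, hom_ρ ι.hom g c⟩

end IsComponent

/-! ### Every `Π`-orbit is (the image of) a component -/

omit [IsTopologicalGroup G] in
/-- **Every `Π`-orbit of an object `X` of `T[A]` is the image of a component of `X`**: the orbit,
with the induced action, is a countable `Π`-set with open stabilisers mapping to `A` through `X`; it
is nonempty and transitive, hence connected; and `X` is the coproduct, in `B^temp(Π)` hence in `T[A]`,
of the orbit and its complement. [cite: MochizukiSemiAnbd2006, Def A.3(i) p.82] -/
theorem overPrime_exists_isComponent_orbit {A : BTemp G} (X : Over' A) (x₀ : X.obj.obj.V) :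
    ∃ (C : Over' A) (ι : C ⟶ X), IsComponent ι ∧
      ∀ y : X.obj.obj.V, (∃ c : C.obj.obj.V, ι.hom.hom.hom c = y) ↔ ∃ g : G, X.obj.obj.ρ g x₀ = y := by
  classical
  obtain ⟨pX⟩ := X.property
  let T : BTemp G := X.obj
  letI : MulAction G T.obj.V := Action.instMulAction T.obj
  -- sub-`Π`-sets of `T` as objects of `B^temp(Π)`, with their inclusions
  let B : SubMulAction G T.obj.V → BTemp G := fun S =>
    ⟨{ V := S, ρ := (Action.ofMulAction G S).ρ }, by
      haveI : Countable T.obj.V := T.property.1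
      refine ⟨inferInstanceAs (Countable S), fun (y : S) => ?_⟩
      change IsOpen {g : G | (Action.ofMulAction G S).ρ g y = y}
      have : {g : G | (Action.ofMulAction G S).ρ g y = y} = {g : G | T.obj.ρ g y.1 = y.1} := by
        ext g
        simp only [Set.mem_setOf_eq]
        change g • y = y ↔ g • (y.1 : T.obj.V) = y.1
        rw [Subtype.ext_iff, SubMulAction.val_smul]
      rw [this]
      exact T.property.2 y.1⟩
  let j : ∀ S : SubMulAction G T.obj.V, B S ⟶ T := fun S =>
    ObjectProperty.homMk
      { hom := TypeCat.ofHom fun y : S => (y.1 : T.obj.V)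
        comm := fun _ => by
          apply ConcreteCategory.hom_ext
          intro y
          rfl }
  -- the orbit of `x₀` and its complement
  let S : SubMulAction G T.obj.V :=
    { carrier := MulAction.orbit G x₀
      smul_mem' := fun g {_} hy => MulAction.mem_orbit_of_mem_orbit g hy }
  let Sc : SubMulAction G T.obj.V :=
    { carrier := (S : Set T.obj.V)ᶜ
      smul_mem' := fun g {y} hy => by
        intro hgy
        apply hy
        have := S.smul_mem g⁻¹ hgy
        rwa [inv_smul_smul] at this }
  -- `T = S ⊔ Sc` in `B^temp(Π)`
  let d : ∀ s : BinaryCofan (B S) (B Sc), T.obj.V → s.pt.obj.V := fun s y =>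
    if hy : y ∈ S then s.inl.hom.hom (⟨y, hy⟩ : S) else s.inr.hom.hom (⟨y, hy⟩ : Sc)
  have hd₁ : ∀ s y (hy : y ∈ S), d s y = s.inl.hom.hom (⟨y, hy⟩ : S) := fun s y hy => by
    simp only [d, dif_pos hy]
  have hd₂ : ∀ s y (hy : y ∉ S), d s y = s.inr.hom.hom (⟨y, hy⟩ : Sc) := fun s y hy => by
    simp only [d, dif_neg hy]
  have hcol : Nonempty (IsColimit (BinaryCofan.mk (j S) (j Sc))) := by
    refine ⟨BinaryCofan.isColimitMk
      (fun s => ObjectProperty.homMk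
        { hom := TypeCat.ofHom (d s)
          comm := fun g => ?_ }) ?_ ?_ ?_⟩
    · apply ConcreteCategory.hom_ext
      intro y
      change d s (g • y) = s.pt.obj.ρ g (d s y)
      by_cases hy : y ∈ S
      · rw [hd₁ s y hy, hd₁ s (g • y) (S.smul_mem g hy)]
        exact ConcreteCategory.congr_hom (s.inl.hom.comm g) (⟨y, hy⟩ : S)
      · rw [hd₂ s y hy, hd₂ s (g • y) (Sc.smul_mem g hy)]
        exact ConcreteCategory.congr_hom (s.inr.hom.comm g) (⟨y, hy⟩ : Sc)
    · intro s
      apply ObjectProperty.hom_ext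
      apply Action.hom_ext
      apply ConcreteCategory.hom_ext
      intro y
      change d s (y.1 : T.obj.V) = s.inl.hom.hom y
      rw [hd₁ s y.1 y.2]
    · intro s
      apply ObjectProperty.hom_ext
      apply Action.hom_ext
      apply ConcreteCategory.hom_ext
      intro y
      change d s (y.1 : T.obj.V) = s.inr.hom.hom y
      rw [hd₂ s y.1 y.2]
    · intro s m h₁ h₂
      apply ObjectProperty.hom_ext
      apply Action.hom_ext
      apply ConcreteCategory.hom_ext
      intro y
      change m.hom.hom y = d s y
      by_cases hy : y ∈ S
      · rw [hd₁ s y hy, ← h₁]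
        rfl
      · rw [hd₂ s y hy, ← h₂]
        rfl
  -- lift to `T[A]`
  let C : Over' A := ⟨B S, ⟨j S ≫ pX⟩⟩
  let D : Over' A := ⟨B Sc, ⟨j Sc ≫ pX⟩⟩
  let ι : C ⟶ X := ObjectProperty.homMk (j S)
  let κ : D ⟶ X := ObjectProperty.homMk (j Sc)
  obtain ⟨hcol'⟩ := overPrime_binaryCofan_isColimit_of_obj ι κ hcol.some
  have hconn : IsConnectedObj C := by
    refine (overPrime_isConnectedObj_iff_transitive C).mpr ⟨⟨⟨x₀, MulAction.mem_orbit_self x₀⟩⟩, ?_⟩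
    rintro ⟨_, ⟨g₁, rfl⟩⟩ ⟨_, ⟨g₂, rfl⟩⟩
    refine ⟨g₂ * g₁⁻¹, Subtype.ext ?_⟩
    change (g₂ * g₁⁻¹) • (g₁ • x₀) = g₂ • x₀
    rw [mul_smul, inv_smul_smul]
  refine ⟨C, ι, ⟨hconn, D, κ, ⟨hcol'⟩⟩, fun y => ⟨?_, ?_⟩⟩
  · rintro ⟨⟨_, ⟨g, rfl⟩⟩, rfl⟩
    exact ⟨g, rfl⟩
  · rintro ⟨g, rfl⟩
    exact ⟨⟨g • x₀, ⟨g, rfl⟩⟩, rfl⟩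

end Literature.AnabelianGeometry.SemiGraphs
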